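import Summits.Parity.GeneralizedHardyLittlewood.Theorems.Dhl42Marginals

/-!
# DHL[42,2] certificate — Lemma 6.2 for general data, part 1: `CertSetup` and its quantities

§4 `CertSetup n J I`: the data and the 17 hypotheses of Lemma 6.2 in dimension `k = n + 1` for a
GENERAL bounded measurable symmetric `F₀` supported in `S·R_k`, symmetric measurable `Ω ⊆ S·R_k`,
measurable `Ω' ⊆ K·R_{k−1}`, a finite symmetric measurable cover `E_j` of `S·R_k ∖ Ω` with depths
`e_j`, and bins `β_{ji}` covering `(S − e_j − K, S]`; the quantities of eq. (6.3) and the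
product-space integrands `aI, bI, yI, errI`; §5 (first half) tameness of everything,
`F₀ = F + F₀1_{Ω^c}`, `(F₀)₁ = F₁ + E₁` (`marg_F0_eq`), every summand of (4.3) equals
`J^K − L_G − 2∫_{Ω'}E₁(F₀)₁` (`varLHS_eq`), `⟨F,F⟩ ≤ I(F₀)` (`integral_F_sq_le`), the box
`[0,S] × S·R_n` and tameness of the cross-term integrands. Continued in `Dhl42CertIneq` (same
namespace `CertSetup`).

Origin: `Dhl42/CertificateInequality.lean` of the DHL[42,2] certificate package (pub-dhl42 bundle,
archive blob `18cce9e3`; sha256[:16] of the file `ba7c9b2361ca6afe`; paper snapshot =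
`paper/main.tex` v1), lines :408–:697; statements and proofs unchanged except: namespace `TpY4Dhl42`
→ `Summit.Parity.GeneralizedHardyLittlewood.Theorems.Dhl42`, the package's `simplexSet n B` replaced
by the tree's definitionally equal `Literature.NumberTheory.Sieve.scaledSimplex n B` (also inside
declaration names), docstrings added where missing, `#print axioms` lines dropped. Package-internal
references in the verbatim docstrings (`Dhl42/….lean`, `Assumed.…`, `row 9…`, `gen n`,
`inputs/COMPARE.md`) refer to that package (paper Appendix B).

Declarations (50): `CertSetup`, `F`, `Fc`, `G`, `JK`, `LG`, `JOmega`, `errInner`, `indCount`, `A`,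
`lenE`, `b`, `B`, `cross`, `aI`, `a`, `bI`, `b'`, `yI`, `y`, `errI`, `volume_simplex_ne_top`,
`tame_F0`, `tame_F`, `measurableSet_compl`, `tame_Fc`, `F0_eq_F_add_Fc`, `F_symm`, `margAt_F`,
`margAt_F0`, `F0_insertNth`, `insertNth_mem_E`, `marg_F0_eq`, `tame_margF0`, `tame_margF`,
`tame_margFc`, `integral_margF_mul_G`, `integral_G_sq`, `JK_eq`, `varLHS_eq`, `integral_F_sq_le`,
`box`, `volume_box_ne_top`, `mem_box_of_cons_mem_E`, `tame_box`, `measurable_F0_consPair`,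
`measurable_margF0_snd`, `tame_aI`, `tame_bI`, `tame_yI`.
-/

open MeasureTheory Set Filter
open Literature.NumberTheory.Sieve (scaledSimplex measurableSet_scaledSimplex volume_scaledSimplex_lt_top)

namespace Summit.Parity.GeneralizedHardyLittlewood.Theorems.Dhl42

noncomputable section

/-! ### §4. The data of Lemma 6.2 -/

/-- The data and hypotheses of the paper's Lemma 6.2 (`lem:cert`) in dimension `k = n + 1`, for a
GENERAL bounded measurable symmetric `F₀` supported in `S·R_k` (the paper takes the marked
product–radial `F₀` of eq. (6.1); only these properties are used in the proof): symmetric measurable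
`Ω ⊆ S·R_k`, measurable `Ω' ⊆ K·R_{k−1}`, a finite cover `Ω^c = S·R_k \ Ω ⊆ ⋃_j E_j` by symmetric
measurable `E_j ⊆ {t ∈ S·R_k : Σt > S − e_j}`, and for each `j` finitely many measurable bins
`β_{ji} ⊆ ℝ` covering `(S − e_j − K, S]` (the paper's `[τ_{0,j}, S] ⊆ ⋃_i β_{ji}`, `τ_{0,j} = S − e_j − K`).
Symmetry of `Ω'` (assumed in the paper) is not needed. -/
structure CertSetup (n : ℕ) (J : Type) [Fintype J] (I : J → Type) [∀ j, Fintype (I j)] where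
  /-- `S = 1 + ε` -/
  S : ℝ
  /-- `K = 1 − ε` -/
  K : ℝ
  /-- the trial function `F₀` -/
  F0 : (Fin (n + 1) → ℝ) → ℝ
  /-- `Ω ⊆ S·R_k` -/
  Ω : Set (Fin (n + 1) → ℝ)
  /-- `Ω' ⊆ K·R_{k−1}` -/
  Ω' : Set (Fin n → ℝ)
  /-- the cover members `E_j` -/
  E : J → Set (Fin (n + 1) → ℝ)
  /-- the depths `e_j` -/
  e : J → ℝ
  /-- the bins `β_{ji}` -/
  β : (j : J) → I j → Set ℝ
  measurable_F0 : Measurable F0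
  exists_bound_F0 : ∃ C, ∀ t, |F0 t| ≤ C
  F0_eq_zero : ∀ t, t ∉ scaledSimplex (n + 1) S → F0 t = 0
  F0_symm : ∀ (σ : Equiv.Perm (Fin (n + 1))) (t : Fin (n + 1) → ℝ), F0 (t ∘ ⇑σ) = F0 t
  measurableSet_Ω : MeasurableSet Ω
  Ω_subset : Ω ⊆ scaledSimplex (n + 1) S
  Ω_symm : ∀ (σ : Equiv.Perm (Fin (n + 1))) (t : Fin (n + 1) → ℝ), t ∘ ⇑σ ∈ Ω ↔ t ∈ Ω
  measurableSet_Ω' : MeasurableSet Ω'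
  Ω'_subset : Ω' ⊆ scaledSimplex n K
  measurableSet_E : ∀ j, MeasurableSet (E j)
  E_subset : ∀ j, E j ⊆ scaledSimplex (n + 1) S
  E_symm : ∀ (j : J) (σ : Equiv.Perm (Fin (n + 1))) (t : Fin (n + 1) → ℝ), t ∘ ⇑σ ∈ E j ↔ t ∈ E j
  lt_sum_of_mem_E : ∀ (j : J) (t : Fin (n + 1) → ℝ), t ∈ E j → S - e j < ∑ i, t i
  cover : scaledSimplex (n + 1) S \ Ω ⊆ ⋃ j, E j
  measurableSet_β : ∀ j i, MeasurableSet (β j i)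
  β_cover : ∀ (j : J) (s : ℝ), S - e j - K < s → s ≤ S → ∃ i, s ∈ β j i

namespace CertSetup

variable {n : ℕ} {J : Type} [Fintype J] {I : J → Type} [∀ j, Fintype (I j)]
variable (D : CertSetup n J I)

/-! #### The functions `F = F₀ 1_Ω`, `F₀ 1_{Ω^c}`, `G = (F₀)₁ 1_{Ω'}` and the paper's quantities -/

/-- `F := F₀ 1_Ω` (Lemma 6.2). -/
def F : (Fin (n + 1) → ℝ) → ℝ := D.Ω.indicator D.F0

/-- `F₀ 1_{Ω^c}`, `Ω^c := S·R_k \ Ω` (so that `F₀ = F + F₀ 1_{Ω^c}` and `E_m = (F₀ 1_{Ω^c})_m`). -/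
def Fc : (Fin (n + 1) → ℝ) → ℝ := (scaledSimplex (n + 1) D.S \ D.Ω).indicator D.F0

/-- `G := (F₀)₁ 1_{Ω'}`; by the symmetry of `F₀` this is `G_m = (F₀)_m 1_{Ω'}` for every `m`. -/
def G : (Fin n → ℝ) → ℝ := D.Ω'.indicator (marg D.F0)

/-- `J^K(F₀) = ∫_{K·R_{k−1}} (F₀)₁²`. -/
def JK : ℝ := ∫ t' in scaledSimplex n D.K, marg D.F0 t' ^ 2

/-- `L_G = ∫_{K·R_{k−1} \ Ω'} (F₀)₁²` (eq. (6.3)). -/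
def LG : ℝ := ∫ t' in scaledSimplex n D.K \ D.Ω', marg D.F0 t' ^ 2

/-- `∫_{Ω'} (F₀)₁²`. -/
def JOmega : ℝ := ∫ t' in D.Ω', marg D.F0 t' ^ 2

/-- The error inner product `∫_{Ω'} E₁ (F₀)₁` of the proof of Lemma 6.2, `E₁ = (F₀ 1_{Ω^c})₁`. -/
def errInner : ℝ := ∫ t' in D.Ω', marg D.Fc t' * marg D.F0 t'

/-- `N_β(t) = #{m : t_m ∈ β}` as a real number (the allowance of Lemma 6.2 dropping `Σ t^{(m)} ≤ K`). -/
def indCount (β : Set ℝ) (t : Fin (n + 1) → ℝ) : ℝ := ∑ m, ind β (t m)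

/-- `A_{jβ} = ∫_{E_j} F₀² N_β` (eq. (6.3)). -/
def A (j : J) (β : Set ℝ) : ℝ := ∫ t in D.E j, D.F0 t ^ 2 * indCount β t

/-- `ℓ_{jβ}(t') = |{s ∈ β ∩ [0, S − Σt'] : (s, t') ∈ E_j}|` (Lebesgue measure). -/
def lenE (j : J) (β : Set ℝ) (t' : Fin n → ℝ) : ℝ :=
  (volume {s : ℝ | (s ∈ β ∧ s ∈ Icc (0 : ℝ) (D.S - ∑ i, t' i)) ∧
    (Fin.cons s t' : Fin (n + 1) → ℝ) ∈ D.E j}).toReal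

/-- `B_{jβ}/k = ∫_{Ω'} (F₀)₁² ℓ_{jβ}` (eq. (6.3), in the `Ω'`-restricted form of its last sentence). -/
def b (j : J) (β : Set ℝ) : ℝ := ∫ t' in D.Ω', marg D.F0 t' ^ 2 * D.lenE j β t'

/-- `B_{jβ} = k ∫_{Ω'} (F₀)₁² ℓ_{jβ}`. -/
def B (j : J) (β : Set ℝ) : ℝ := ((n : ℝ) + 1) * D.b j β

/-- The total cross term `Σ_j Σ_i √(A_{ji} B_{ji})` of eq. (6.2). -/
def cross : ℝ := ∑ j, ∑ i, Real.sqrt (D.A j (D.β j i) * D.B j (D.β j i))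

/-! Product-space (`(s, t') ∈ ℝ × ℝⁿ`, `t = (s, t')`) integrands of the proof. -/

/-- integrand of `A_{jβ}/k` after integrating out the counted coordinate first -/
def aI (j : J) (β : Set ℝ) (p : ℝ × (Fin n → ℝ)) : ℝ :=
  ind (D.E j) (Fin.cons p.1 p.2 : Fin (n + 1) → ℝ) * ind β p.1 * D.F0 (Fin.cons p.1 p.2) ^ 2

/-- `a_{jβ} = A_{jβ}/k` -/
def a (j : J) (β : Set ℝ) : ℝ := ∫ p, D.aI j β p

/-- integrand of `B_{jβ}/k` before integrating out `s` -/
def bI (j : J) (β : Set ℝ) (p : ℝ × (Fin n → ℝ)) : ℝ :=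
  ind (D.E j) (Fin.cons p.1 p.2 : Fin (n + 1) → ℝ) * ind β p.1 * (marg D.F0 p.2 ^ 2 * ind D.Ω' p.2)

/-- `∫ bI` (shown equal to `b`) -/
def b' (j : J) (β : Set ℝ) : ℝ := ∫ p, D.bI j β p

/-- integrand of the binned error term `X_{jβ}/k` -/
def yI (j : J) (β : Set ℝ) (p : ℝ × (Fin n → ℝ)) : ℝ :=
  ind (D.E j) (Fin.cons p.1 p.2 : Fin (n + 1) → ℝ) * ind β p.1 * (|marg D.F0 p.2| * ind D.Ω' p.2) *
    |D.F0 (Fin.cons p.1 p.2)|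

/-- `y_{jβ} = X_{jβ}/k` -/
def y (j : J) (β : Set ℝ) : ℝ := ∫ p, D.yI j β p

/-- the integrand of `errInner` on the product space -/
def errI (p : ℝ × (Fin n → ℝ)) : ℝ := ind D.Ω' p.2 * marg D.F0 p.2 * D.Fc (Fin.cons p.1 p.2)

/-! #### Tameness and integrability -/

/-- `B·R_k` has finite measure (`≠ ⊤` form). -/
theorem volume_simplex_ne_top (k : ℕ) (B : ℝ) : volume (scaledSimplex k B) ≠ ⊤ :=
  (volume_scaledSimplex_lt_top k B).ne

/-- `F₀` is tame on `S·R_k` (hypotheses `measurable_F0`, `exists_bound_F0`, `F0_eq_zero` of the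
setup). -/
theorem tame_F0 : Tame (scaledSimplex (n + 1) D.S) D.F0 := by
  obtain ⟨C, hC⟩ := D.exists_bound_F0
  exact ⟨D.measurable_F0, ⟨max C 0, le_max_right _ _, fun t => le_trans (hC t) (le_max_left _ _)⟩,
    D.F0_eq_zero⟩

/-- `F = F₀ 1_Ω` is tame on `S·R_k`. -/
theorem tame_F : Tame (scaledSimplex (n + 1) D.S) D.F := D.tame_F0.indicator D.measurableSet_Ω

/-- `Ω^c = S·R_k ∖ Ω` is measurable. -/
theorem measurableSet_compl : MeasurableSet (scaledSimplex (n + 1) D.S \ D.Ω) :=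
  (measurableSet_scaledSimplex _ _).diff D.measurableSet_Ω

/-- `F₀ 1_{Ω^c}` is tame on `S·R_k`. -/
theorem tame_Fc : Tame (scaledSimplex (n + 1) D.S) D.Fc := D.tame_F0.indicator D.measurableSet_compl

/-- `F₀ = F + F₀ 1_{Ω^c}` pointwise (`Ω ⊆ S·R_k` and `F₀` vanishes off `S·R_k`). -/
theorem F0_eq_F_add_Fc (t : Fin (n + 1) → ℝ) : D.F0 t = D.F t + D.Fc t := by
  unfold F Fc
  by_cases ht : t ∈ scaledSimplex (n + 1) D.S
  · by_cases hΩ : t ∈ D.Ω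
    · rw [indicator_of_mem hΩ, indicator_of_notMem (fun h => h.2 hΩ), add_zero]
    · rw [indicator_of_notMem hΩ, indicator_of_mem (show t ∈ scaledSimplex (n + 1) D.S \ D.Ω from ⟨ht, hΩ⟩),
        zero_add]
  · rw [indicator_of_notMem (fun h => ht (D.Ω_subset h)), indicator_of_notMem (fun h => ht h.1),
      add_zero, D.F0_eq_zero t ht]

/-- `F = F₀ 1_Ω` is a symmetric function (both `F₀` and `Ω` are). -/
theorem F_symm (σ : Equiv.Perm (Fin (n + 1))) (t : Fin (n + 1) → ℝ) : D.F (t ∘ ⇑σ) = D.F t := by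
  unfold F
  by_cases ht : t ∈ D.Ω
  · rw [indicator_of_mem ht, indicator_of_mem ((D.Ω_symm σ t).2 ht), D.F0_symm]
  · rw [indicator_of_notMem ht, indicator_of_notMem (fun h => ht ((D.Ω_symm σ t).1 h))]

/-- Every marginal of `F` is its first marginal: `F_m = F₁` (symmetry). -/
theorem margAt_F (m : Fin (n + 1)) : margAt m D.F = marg D.F := margAt_eq_marg_of_symm D.F_symm m

/-- Every marginal of `F₀` is its first marginal: `(F₀)_m = (F₀)₁` (symmetry). -/
theorem margAt_F0 (m : Fin (n + 1)) : margAt m D.F0 = marg D.F0 := margAt_eq_marg_of_symm D.F0_symm m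

/-- `F₀ (Fin.insertNth m s t') = F₀ (s, t')`: inserting the coordinate at place `m` instead of place
`0` is a permutation, under which `F₀` is invariant. -/
theorem F0_insertNth (m : Fin (n + 1)) (s : ℝ) (t' : Fin n → ℝ) :
    D.F0 (Fin.insertNth m s t') = D.F0 (Fin.cons s t') := by
  rw [insertNth_eq_cons_comp_cycleRange, D.F0_symm]

/-- `Fin.insertNth m s t' ∈ E_j ↔ (s, t') ∈ E_j` (the cover members are symmetric). -/
theorem insertNth_mem_E (j : J) (m : Fin (n + 1)) (s : ℝ) (t' : Fin n → ℝ) :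
    (Fin.insertNth m s t' : Fin (n + 1) → ℝ) ∈ D.E j ↔ (Fin.cons s t' : Fin (n + 1) → ℝ) ∈ D.E j := by
  rw [insertNth_eq_cons_comp_cycleRange, D.E_symm]

/-- `(F₀)₁ = F₁ + E₁`. -/
theorem marg_F0_eq (t' : Fin n → ℝ) : marg D.F0 t' = marg D.F t' + marg D.Fc t' := by
  unfold marg
  rw [← integral_add (D.tame_F.integrable_cons_left t') (D.tame_Fc.integrable_cons_left t')]
  congr 1
  funext s
  exact D.F0_eq_F_add_Fc _

/-- `(F₀)₁` is tame on `S·R_n` (`Tame.marg`). -/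
theorem tame_margF0 : Tame (scaledSimplex n D.S) (marg D.F0) := D.tame_F0.marg
/-- `F₁` is tame on `S·R_n`. -/
theorem tame_margF : Tame (scaledSimplex n D.S) (marg D.F) := D.tame_F.marg
/-- `E₁ = (F₀ 1_{Ω^c})₁` is tame on `S·R_n`. -/
theorem tame_margFc : Tame (scaledSimplex n D.S) (marg D.Fc) := D.tame_Fc.marg

/-! #### The identity `2⟨F_m, G_m⟩ − ⟨G_m, G_m⟩ = J^K − L_G − 2 ∫_{Ω'} E₁ (F₀)₁` -/

/-- `⟨F_m, G⟩ = ∫_{Ω'} (F₀)₁² − ∫_{Ω'} E₁ (F₀)₁` for every `m` (`F_m = F₁ = (F₀)₁ − E₁` on using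
`marg_F0_eq`). -/
theorem integral_margF_mul_G (m : Fin (n + 1)) :
    ∫ t', margAt m D.F t' * D.G t' = D.JOmega - D.errInner := by
  rw [D.margAt_F]
  have h1 : ∀ t', marg D.F t' * D.G t' =
      D.Ω'.indicator (fun t' => marg D.F0 t' ^ 2 - marg D.Fc t' * marg D.F0 t') t' := by
    intro t'
    unfold G
    by_cases ht : t' ∈ D.Ω'
    · rw [indicator_of_mem ht, indicator_of_mem ht, D.marg_F0_eq]
      ring
    · rw [indicator_of_notMem ht, indicator_of_notMem ht, mul_zero]
  simp_rw [h1]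
  rw [integral_indicator D.measurableSet_Ω', integral_sub]
  · rfl
  · exact (D.tame_margF0.sq).integrableOn (volume_simplex_ne_top _ _) _
  · exact (D.tame_margFc.mul D.tame_margF0).integrableOn (volume_simplex_ne_top _ _) _

/-- `⟨G, G⟩ = ∫_{Ω'} (F₀)₁²`. -/
theorem integral_G_sq : ∫ t', D.G t' ^ 2 = D.JOmega := by
  have h1 : ∀ t', D.G t' ^ 2 = D.Ω'.indicator (fun t' => marg D.F0 t' ^ 2) t' := by
    intro t'
    unfold G
    by_cases ht : t' ∈ D.Ω'
    · rw [indicator_of_mem ht, indicator_of_mem ht]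
    · rw [indicator_of_notMem ht, indicator_of_notMem ht]; ring
  simp_rw [h1]
  rw [integral_indicator D.measurableSet_Ω']
  rfl

/-- `J^K = ∫_{Ω'} (F₀)₁² + L_G` (`Ω' ⊆ K·R_n`, splitting the domain of `J^K`). -/
theorem JK_eq : D.JK = D.JOmega + D.LG := by
  have h := setIntegral_sdiff D.measurableSet_Ω'
    ((D.tame_margF0.sq).integrableOn (volume_simplex_ne_top _ _) (scaledSimplex n D.K)) D.Ω'_subset
  unfold JK JOmega LG
  linarith

/-- The left-hand side of (4.3) for `(F, G_m = G)`: every summand equals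
`J^K − L_G − 2∫_{Ω'} E₁ (F₀)₁`. -/
theorem varLHS_eq : varLHS D.F (fun _ => D.G) = ((n : ℝ) + 1) * (D.JK - D.LG - 2 * D.errInner) := by
  have h : ∀ m : Fin (n + 1),
      (2 * ∫ t', margAt m D.F t' * D.G t') - ∫ t', D.G t' ^ 2 = D.JK - D.LG - 2 * D.errInner := by
    intro m
    rw [D.integral_margF_mul_G m, D.integral_G_sq, D.JK_eq]
    ring
  unfold varLHS
  rw [Finset.sum_congr rfl fun m _ => h m, Finset.sum_const, Finset.card_univ, Fintype.card_fin,
    nsmul_eq_mul, Nat.cast_add, Nat.cast_one]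

/-- `⟨F, F⟩ ≤ I(F₀)`. -/
theorem integral_F_sq_le : ∫ t, D.F t ^ 2 ≤ ∫ t, D.F0 t ^ 2 := by
  refine integral_mono ((D.tame_F.sq).integrable (volume_simplex_ne_top _ _))
    ((D.tame_F0.sq).integrable (volume_simplex_ne_top _ _)) fun t => ?_
  unfold F
  by_cases ht : t ∈ D.Ω
  · simp [indicator_of_mem ht]
  · simp [indicator_of_notMem ht, sq_nonneg]

/-! #### The cross term -/

/-- The box `[0, S] × S·R_n`, which contains the support of every product-space integrand. -/
def box : Set (ℝ × (Fin n → ℝ)) := Icc 0 D.S ×ˢ scaledSimplex n D.S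

/-- The box `[0, S] × S·R_n` has finite measure. -/
theorem volume_box_ne_top : volume D.box ≠ ⊤ :=
  volume_prod_ne_top measure_Icc_lt_top.ne (volume_simplex_ne_top _ _)

/-- If `(s, t') ∈ E_j` then `(s, t')` lies in the box `[0, S] × S·R_n` (`E_j ⊆ S·R_k`). -/
theorem mem_box_of_cons_mem_E {j : J} {p : ℝ × (Fin n → ℝ)}
    (h : (Fin.cons p.1 p.2 : Fin (n + 1) → ℝ) ∈ D.E j) : p ∈ D.box :=
  Set.mem_prod.2 ⟨mem_Icc_of_cons_mem_scaledSimplex' (D.E_subset j h),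
    tail_mem_scaledSimplex_of_cons_mem (D.E_subset j h)⟩

/-- Integrands `1_{E_j}(s, t') · g(s, t')` with `g` bounded measurable are tame on the box. -/
theorem tame_box {j : J} {g : ℝ × (Fin n → ℝ) → ℝ} (hg : Measurable g) (hb : ∃ C, ∀ p, |g p| ≤ C) :
    Tame D.box fun p => ind (D.E j) (Fin.cons p.1 p.2 : Fin (n + 1) → ℝ) * g p := by
  have hm : Measurable fun p : ℝ × (Fin n → ℝ) => ind (D.E j) (Fin.cons p.1 p.2 : Fin (n + 1) → ℝ) :=
    (measurable_ind (D.measurableSet_E j)).comp continuous_consPair.measurable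
  obtain ⟨C, hC⟩ := bdd_mul (bdd_comp (bdd_ind (D.E j))
    (fun p : ℝ × (Fin n → ℝ) => (Fin.cons p.1 p.2 : Fin (n + 1) → ℝ))) hb
  refine ⟨hm.mul hg, ⟨max C 0, le_max_right _ _, fun p => le_trans (hC p) (le_max_left _ _)⟩,
    fun p hp => ?_⟩
  rw [ind_of_notMem fun h => hp (D.mem_box_of_cons_mem_E h), zero_mul]

/-- `(s, t') ↦ F₀(s, t')` is measurable on the product space. -/
theorem measurable_F0_consPair :
    Measurable fun p : ℝ × (Fin n → ℝ) => D.F0 (Fin.cons p.1 p.2 : Fin (n + 1) → ℝ) :=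
  D.measurable_F0.comp continuous_consPair.measurable

/-- `(s, t') ↦ (F₀)₁(t')` is measurable on the product space. -/
theorem measurable_margF0_snd : Measurable fun p : ℝ × (Fin n → ℝ) => marg D.F0 p.2 :=
  D.tame_margF0.measurable.comp measurable_snd

/-- The integrand `aI` of `a_{jβ} = A_{jβ}/k` is tame on the box (measurable bin `β`). -/
theorem tame_aI (j : J) {β : Set ℝ} (hβ : MeasurableSet β) : Tame D.box (D.aI j β) := by
  refine (D.tame_box (j := j) (((measurable_ind hβ).comp measurable_fst).mul
    (D.measurable_F0_consPair.pow_const 2))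
    (bdd_mul (bdd_comp (bdd_ind β) _) (bdd_sq (bdd_comp D.tame_F0.bdd' _)))).congr' ?_
  funext p
  simp only [aI, Pi.mul_apply, Function.comp_apply]
  ring

/-- The integrand `bI` of `B_{jβ}/k` is tame on the box (measurable bin `β`). -/
theorem tame_bI (j : J) {β : Set ℝ} (hβ : MeasurableSet β) : Tame D.box (D.bI j β) := by
  refine (D.tame_box (j := j) (((measurable_ind hβ).comp measurable_fst).mul
    ((D.measurable_margF0_snd.pow_const 2).mul
      ((measurable_ind D.measurableSet_Ω').comp measurable_snd)))
    (bdd_mul (bdd_comp (bdd_ind β) _) (bdd_mul (bdd_sq (bdd_comp D.tame_margF0.bdd' _))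
      (bdd_comp (bdd_ind D.Ω') _)))).congr' ?_
  funext p
  simp only [bI, Pi.mul_apply, Function.comp_apply]
  ring

/-- The integrand `yI` of the binned error term `y_{jβ}` is tame on the box (measurable bin `β`). -/
theorem tame_yI (j : J) {β : Set ℝ} (hβ : MeasurableSet β) : Tame D.box (D.yI j β) := by
  refine (D.tame_box (j := j) ((((measurable_ind hβ).comp measurable_fst).mul
    ((D.measurable_margF0_snd.abs).mul ((measurable_ind D.measurableSet_Ω').comp measurable_snd))).mul
      D.measurable_F0_consPair.abs)
    (bdd_mul (bdd_mul (bdd_comp (bdd_ind β) _) (bdd_mul (bdd_abs (bdd_comp D.tame_margF0.bdd' _))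
      (bdd_comp (bdd_ind D.Ω') _))) (bdd_abs (bdd_comp D.tame_F0.bdd' _)))).congr' ?_
  funext p
  simp only [yI, Pi.mul_apply, Function.comp_apply]
  ring

end CertSetup

end

end Summit.Parity.GeneralizedHardyLittlewood.Theorems.Dhl42
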